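import Summits.AtomisticToContinuum.HydrodynamicLimit.Theorems.EnskogAdjointDualityAdjointEnskogTestFamilyROperatorKappaZeroPrep
import Summits.AtomisticToContinuum.HydrodynamicLimit.Theorems.EnskogAdjointDualityDualityReductionLMeasurable
import Literature.Analysis.FunctionSpaces.PeriodicLogCost
import HarnessLib

/-!
# K2R refutation, stub `operatorKappaZero` — preparation 2: budgets, the operator, the torus

Route `EnskogAdjointDuality` of `AtomisticToContinuum/HydrodynamicLimit`, crux K2R
`AdjointEnskogTestFamilyR` (stmt-AtomisticToContinuum-11592), line `refutation`, registered stub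
`stub_operatorKappaZero`. Second preparation file (notation as in `…ROperatorKappaZeroPrep`: the
critical weight `Θ` with equation `hΘ`, the dual gain kernel `I` with equation `hI`):

* the delocalisation budget `∫ (1+|U|²) ∫_{S²} I₀^R(U, ω) dσ dU ≤ 32π² J_R + 1760π`
  (`k2r_ref_ok0_Lambda_le`; energy bound `|w'|² ≤ |v|² + |w|²`, the flux-moment budget
  `∫∫ q₊ M (1+|w|²) ≤ 4π(4|v|+9)` and the radial moments of `stub_sphereCalculus`);
* the bracket-piece bound `|∫∫ q₊ M g| ≤ D · 4π(4|v|+9)` for `|g| ≤ D(1+|w|²)` (`k2r_ref_ok0_piece_le`);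
* the test-side bracket on the corrector part: joint measurability in `(x, v)`, the pointwise bound
  `|Lκ(x, v)| ≤ 134π Y₀ρ₀ C (1+|v|²)²`, and integrability against `Θ₀^R(v) c(x)` on `𝕋³ × ℝ³`
  (`k2r_ref_ok0_operator`);
* the torus: the addition formula `cos(2π(x − εω)₀) = cos(2πx₀)cos(2πεω₀) + sin(2πx₀)sin(2πεω₀)`
  (`k2r_ref_ok0_cosCoord_sub`, keyed sub-goal `stub_operatorKappaZero_prep2`) and the delocalised
  gain functional: measurability, bounds, and the exchange
  `∫ cos(2πx₀) ∫_{S²} Ψ(x + εω, ω) dσ dx = ∫∫ [cos(2πx₀)cos(2πεω₀) + sin(2πx₀)sin(2πεω₀)] Ψ(x, ω)`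
  by the translation invariance of `𝕋³` (`k2r_ref_ok0_deloc_swap`).

References: C. Cercignani, R. Illner, M. Pulvirenti, *The Mathematical Theory of Dilute Gases* (1994),
§3.1 [CIP1994].
-/

noncomputable section

open MeasureTheory Set Filter Function
open scoped InnerProductSpace Real

namespace Summit.AtomisticToContinuum.HydrodynamicLimit.Theorems.EnskogAdjointDuality

open Literature.MathematicalPhysics.KineticTheory Literature.Analysis.FluidPDE Literature.Analysis.FunctionSpaces
open Literature.Analysis.UnboundedOperators (collisionFrequency)

variable {Θ : ℝ → V3 → ℝ} {I : ℝ → V3 → V3 → ℝ}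
variable (hΘ : ∀ R v, Θ R v = ((1 + ‖v‖ ^ 2) ^ 3)⁻¹ * Real.exp (-‖v‖ ^ 2 / R))
  (hI : ∀ R U n, I R U n = (1 / 2 : ℝ) * Real.exp (-(‖U‖ ^ 2 - ⟪U, n⟫_ℝ ^ 2) / 2) *
    (∫ b, max (⟪U, n⟫_ℝ - b) 0 * (Real.exp (-b ^ 2 / 2) / Real.sqrt (2 * π))) *
    ∫ E in Ioi (⟪U, n⟫_ℝ ^ 2), ((1 + E) ^ 3)⁻¹ * Real.exp (-E / R))
include hΘ hI

/-! ## Two budgets -/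

omit hΘ hI in
/-- **Bound of a bracket piece.** For a continuous `g` on `S² × ℝ³` with `|g(ω, w)| ≤ D (1 + |w|²)`
(`D ≥ 0`): `(ω, w) ↦ ((v-w)·ω)₊ M(w) g(ω, w)` is integrable on `σ ⊗ dw` and
`|∫∫ ((v-w)·ω)₊ M(w) g| ≤ D · 4π(4|v| + 9)` (the flux-moment budget of `stub_kappaOperator`).
[cite: CIP1994, §7.2 (2.13)] -/
theorem k2r_ref_ok0_piece_le {g : Metric.sphere (0 : V3) 1 × V3 → ℝ} (hg : Continuous g) {D : ℝ}
    (hD : 0 ≤ D) (v : V3) (hb : ∀ p, |g p| ≤ D * (1 + ‖p.2‖ ^ 2)) :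
    Integrable (fun p : Metric.sphere (0 : V3) 1 × V3 =>
        max ⟪v - p.2, (p.1 : V3)⟫_ℝ 0 * globalMaxwellian p.2 * g p)
      ((sphereMeasure : Measure (Metric.sphere (0 : V3) 1)).prod volume) ∧
    |∫ p : Metric.sphere (0 : V3) 1 × V3, max ⟪v - p.2, (p.1 : V3)⟫_ℝ 0 * globalMaxwellian p.2 * g p
        ∂((sphereMeasure : Measure (Metric.sphere (0 : V3) 1)).prod volume)| ≤
      D * (4 * π * (4 * ‖v‖ + 9)) := by
  have I4 := k2r_ref_ko_integrable_piece (G := fun p : Metric.sphere (0 : V3) 1 × V3 => 1 + ‖p.2‖ ^ 2)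
    (by fun_prop) zero_le_one v
    (fun p => by rw [abs_of_nonneg (by positivity), one_mul]; nlinarith [sq_nonneg ‖v‖])
  have Ig := k2r_ref_ko_integrable_piece hg hD v fun p => (hb p).trans (by nlinarith [sq_nonneg ‖v‖, hD])
  refine ⟨Ig, ?_⟩
  calc |∫ p : Metric.sphere (0 : V3) 1 × V3, max ⟪v - p.2, (p.1 : V3)⟫_ℝ 0 * globalMaxwellian p.2 * g p
          ∂((sphereMeasure : Measure (Metric.sphere (0 : V3) 1)).prod volume)|
      ≤ ∫ p : Metric.sphere (0 : V3) 1 × V3, D * (max ⟪v - p.2, (p.1 : V3)⟫_ℝ 0 * globalMaxwellian p.2 *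
          (1 + ‖p.2‖ ^ 2)) ∂((sphereMeasure : Measure (Metric.sphere (0 : V3) 1)).prod volume) := by
        rw [← Real.norm_eq_abs]
        refine norm_integral_le_of_norm_le (I4.const_mul D) (Eventually.of_forall fun p => ?_)
        have h0 : 0 ≤ max ⟪v - p.2, (p.1 : V3)⟫_ℝ 0 * globalMaxwellian p.2 :=
          mul_nonneg (le_max_right _ _) (globalMaxwellian_pos _).le
        rw [Real.norm_eq_abs, abs_mul, abs_of_nonneg h0]
        calc max ⟪v - p.2, (p.1 : V3)⟫_ℝ 0 * globalMaxwellian p.2 * |g p|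
            ≤ max ⟪v - p.2, (p.1 : V3)⟫_ℝ 0 * globalMaxwellian p.2 * (D * (1 + ‖p.2‖ ^ 2)) :=
              mul_le_mul_of_nonneg_left (hb p) h0
          _ = D * (max ⟪v - p.2, (p.1 : V3)⟫_ℝ 0 * globalMaxwellian p.2 * (1 + ‖p.2‖ ^ 2)) := by ring
    _ = D * ∫ p : Metric.sphere (0 : V3) 1 × V3, max ⟪v - p.2, (p.1 : V3)⟫_ℝ 0 * globalMaxwellian p.2 *
          (1 + ‖p.2‖ ^ 2) ∂((sphereMeasure : Measure (Metric.sphere (0 : V3) 1)).prod volume) :=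
        integral_const_mul _ _
    _ ≤ D * (4 * π * (4 * ‖v‖ + 9)) := mul_le_mul_of_nonneg_left (k2r_ref_ko_flux_moment_le v I4) hD

/-- **The delocalisation budget.** `U ↦ (1+|U|²) ∫_{S²} I₀^R(U, ω) dσ` is integrable on `ℝ³` and
`∫ (1+|U|²) ∫_{S²} I₀^R(U, ω) dσ dU ≤ 32π² J_R + 1760π`, `J_R = ∫₀^∞ E²(1+E)⁻³e^{-E/R} dE`: by the
two exchanges of the preparation file this is `∫ Θ₀^R(v) ∫∫ q₊ M (1+|w'|²)`, and
`1 + |w'|² ≤ (1+|v|²)(1+|w|²)`, `∫∫ q₊ M (1+|w|²) ≤ 4π(4|v|+9)`, moments `≤ 20`, `∫ |v|³Θ₀^R = 2πJ_R`.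
[cite: CIP1994, §3.1] -/
theorem k2r_ref_ok0_Lambda_le {R : ℝ} (hR : 1 ≤ R) :
    Integrable (fun U : V3 => (1 + ‖U‖ ^ 2) * ∫ ω : Metric.sphere (0 : V3) 1, I R U ω ∂sphereMeasure) ∧
    ∫ U : V3, (1 + ‖U‖ ^ 2) * ∫ ω : Metric.sphere (0 : V3) 1, I R U ω ∂sphereMeasure ≤
      32 * π ^ 2 * (∫ E in Ioi (0 : ℝ), E ^ 2 * (((1 + E) ^ 3)⁻¹ * Real.exp (-E / R))) + 1760 * π := by
  haveI := isFiniteMeasure_sphereMeasure (E := V3)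
  obtain ⟨hw01, -, -, -⟩ := k2r_ref_ok0_w_facts hΘ hR
  obtain ⟨-, hint, -, hfub⟩ := k2r_ref_ok0_fubini_SV hΘ hI hR (F := fun U : V3 => 1 + ‖U‖ ^ 2)
    (by fun_prop) (CF := 1) (fun U => by rw [abs_of_nonneg (by positivity), one_mul])
    (c := fun _ => (1 : ℝ)) measurable_const (cB := 1) (fun _ => by rw [abs_one])
  simp only [one_mul] at hint hfub
  refine ⟨hint, ?_⟩
  rw [← hfub]
  obtain ⟨-, hP⟩ := k2r_ref_ok0_triple hΘ hI hR
    (K := fun (_ : Metric.sphere (0 : V3) 1) (U : V3) => 1 + ‖U‖ ^ 2)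
    (by show Continuous fun p : Metric.sphere (0 : V3) 1 × V3 => 1 + ‖p.2‖ ^ 2; fun_prop) (CK := 1)
    (fun _ U => by rw [abs_of_nonneg (by positivity), one_mul])
  rw [← hP]
  -- pointwise bound of the bracket
  have hpt : ∀ v : V3, Θ R v * ∫ p : Metric.sphere (0 : V3) 1 × V3,
      max ⟪v - p.2, (p.1 : V3)⟫_ℝ 0 * globalMaxwellian p.2 * (1 + ‖p.2 + ⟪v - p.2, (p.1 : V3)⟫_ℝ • (p.1 : V3)‖ ^ 2)
        ∂((sphereMeasure : Measure (Metric.sphere (0 : V3) 1)).prod volume) ≤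
      Θ R v * ((1 + ‖v‖ ^ 2) * (4 * π * (4 * ‖v‖ + 9))) := by
    intro v
    obtain ⟨-, hle⟩ := k2r_ref_ok0_piece_le (g := fun p : Metric.sphere (0 : V3) 1 × V3 =>
      1 + ‖p.2 + ⟪v - p.2, (p.1 : V3)⟫_ℝ • (p.1 : V3)‖ ^ 2) (by fun_prop) (D := 1 + ‖v‖ ^ 2)
      (by positivity) v (fun p => by
        rw [abs_of_nonneg (by positivity)]
        nlinarith [(k2r_ref_ko_norm_sq_out_le v p.2 p.1).2, mul_nonneg (sq_nonneg ‖v‖) (sq_nonneg ‖p.2‖)])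
    exact mul_le_mul_of_nonneg_left ((le_abs_self _).trans hle) (hw01 v).1
  -- the moments
  obtain ⟨hm, -, ⟨h3i, h3⟩, -⟩ := k2r_ref_R3_facts hR
  have f0 : Integrable (fun v : V3 => ‖v‖ ^ 0 * Θ R v) ∧ ∫ v : V3, ‖v‖ ^ 0 * Θ R v ≤ 20 := by
    simp only [hΘ]; exact hm 0 (by norm_num)
  have f1 : Integrable (fun v : V3 => ‖v‖ ^ 1 * Θ R v) ∧ ∫ v : V3, ‖v‖ ^ 1 * Θ R v ≤ 20 := by
    simp only [hΘ]; exact hm 1 (by norm_num)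
  have f2 : Integrable (fun v : V3 => ‖v‖ ^ 2 * Θ R v) ∧ ∫ v : V3, ‖v‖ ^ 2 * Θ R v ≤ 20 := by
    simp only [hΘ]; exact hm 2 (by norm_num)
  have f3 : Integrable (fun v : V3 => ‖v‖ ^ 3 * Θ R v) ∧ ∫ v : V3, ‖v‖ ^ 3 * Θ R v =
      2 * π * ∫ E in Ioi (0 : ℝ), E ^ 2 * (((1 + E) ^ 3)⁻¹ * Real.exp (-E / R)) := by
    simp only [hΘ]; exact ⟨h3i, h3⟩
  set J : ℝ := ∫ E in Ioi (0 : ℝ), E ^ 2 * (((1 + E) ^ 3)⁻¹ * Real.exp (-E / R))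
  have i1 : Integrable (fun v : V3 => 4 * (‖v‖ ^ 1 * Θ R v)) := f1.1.const_mul 4
  have i0 : Integrable (fun v : V3 => 9 * (‖v‖ ^ 0 * Θ R v)) := f0.1.const_mul 9
  have i3 : Integrable (fun v : V3 => 4 * (‖v‖ ^ 3 * Θ R v)) := f3.1.const_mul 4
  have i2 : Integrable (fun v : V3 => 9 * (‖v‖ ^ 2 * Θ R v)) := f2.1.const_mul 9
  have i10 : Integrable (fun v : V3 => 4 * (‖v‖ ^ 1 * Θ R v) + 9 * (‖v‖ ^ 0 * Θ R v)) := i1.add i0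
  have i103 : Integrable (fun v : V3 => 4 * (‖v‖ ^ 1 * Θ R v) + 9 * (‖v‖ ^ 0 * Θ R v) +
      4 * (‖v‖ ^ 3 * Θ R v)) := i10.add i3
  have hsum : Integrable (fun v : V3 => 4 * π * (4 * (‖v‖ ^ 1 * Θ R v) + 9 * (‖v‖ ^ 0 * Θ R v) +
      4 * (‖v‖ ^ 3 * Θ R v) + 9 * (‖v‖ ^ 2 * Θ R v))) := (i103.add i2).const_mul _
  have hval : ∫ v : V3, 4 * π * (4 * (‖v‖ ^ 1 * Θ R v) + 9 * (‖v‖ ^ 0 * Θ R v) +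
      4 * (‖v‖ ^ 3 * Θ R v) + 9 * (‖v‖ ^ 2 * Θ R v)) =
      4 * π * (4 * (∫ v : V3, ‖v‖ ^ 1 * Θ R v) + 9 * (∫ v : V3, ‖v‖ ^ 0 * Θ R v) +
        4 * (∫ v : V3, ‖v‖ ^ 3 * Θ R v) + 9 * ∫ v : V3, ‖v‖ ^ 2 * Θ R v) := by
    rw [integral_const_mul, integral_add i103 i2, integral_add i10 i3, integral_add i1 i0,
      integral_const_mul, integral_const_mul, integral_const_mul, integral_const_mul]
  calc ∫ v : V3, Θ R v * ∫ p : Metric.sphere (0 : V3) 1 × V3,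
        max ⟪v - p.2, (p.1 : V3)⟫_ℝ 0 * globalMaxwellian p.2 * (1 + ‖p.2 + ⟪v - p.2, (p.1 : V3)⟫_ℝ • (p.1 : V3)‖ ^ 2)
          ∂((sphereMeasure : Measure (Metric.sphere (0 : V3) 1)).prod volume)
      ≤ ∫ v : V3, 4 * π * (4 * (‖v‖ ^ 1 * Θ R v) + 9 * (‖v‖ ^ 0 * Θ R v) +
          4 * (‖v‖ ^ 3 * Θ R v) + 9 * (‖v‖ ^ 2 * Θ R v)) := by
        refine integral_mono_of_nonneg (Eventually.of_forall fun v => ?_) hsum (Eventually.of_forall fun v => ?_)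
        · exact mul_nonneg (hw01 v).1 (integral_nonneg fun p =>
            mul_nonneg (mul_nonneg (le_max_right _ _) (globalMaxwellian_pos _).le) (by positivity))
        · exact (hpt v).trans_eq (by ring)
    _ ≤ 32 * π ^ 2 * J + 1760 * π := by
        rw [hval, f3.2]
        nlinarith [f0.2, f1.2, f2.2, Real.pi_pos, Real.pi_gt_three]

/-! ## The test-side bracket on the corrector part -/

omit hI in
/-- **The operator on the corrector part.** For a jointly continuous corrector `κ` with
`|κ(x, v)| ≤ C(1+|v|²)` and `Lκ(x, v) = ∫_{S²}∫ q₊ Y₀ ρ₀ M(w) [κ(x,v') + κ(x⁺,w') − κ(x,v) − κ(x⁺,w)]`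
(`x⁺ = x + εω`): `(x, v) ↦ Lκ(x, v)` is measurable, `|Lκ(x, v)| ≤ 134π Y₀ρ₀C (1+|v|²)²`
(`stub_kappaOperator`, the bracket-piece bound, `ν(v) ≤ π√(|v|²+3)`), and for every bounded
measurable `c` on `𝕋³` the product `Θ₀^R(v) c(x) Lκ(x, v)` is integrable on `𝕋³ × ℝ³`.
[cite: CIP1994, §3.1] -/
theorem k2r_ref_ok0_operator {Y₀ ρ₀ ε C : ℝ} (hY : 0 ≤ Y₀) (hρ : 0 ≤ ρ₀) (hC : 0 ≤ C)
    {κ : T3 → V3 → ℝ} (hκ : Continuous (uncurry κ)) (hκb : ∀ x v, |κ x v| ≤ C * (1 + ‖v‖ ^ 2))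
    (Lκ : T3 → V3 → ℝ) (hL : ∀ x v, Lκ x v = ∫ ω : Metric.sphere (0 : V3) 1, (∫ w : V3,
      max ⟪v - w, (ω : V3)⟫_ℝ 0 * Y₀ * (ρ₀ * globalMaxwellian w) *
        (κ x (v - ⟪v - w, (ω : V3)⟫_ℝ • (ω : V3)) + κ (x + Torus.proj (ε • (ω : V3))) (w + ⟪v - w, (ω : V3)⟫_ℝ • (ω : V3)) -
          κ x v - κ (x + Torus.proj (ε • (ω : V3))) w)) ∂sphereMeasure) :
    Measurable (fun p : T3 × V3 => Lκ p.1 p.2) ∧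
    (∀ x v, |Lκ x v| ≤ 134 * π * (Y₀ * ρ₀) * C * (1 + ‖v‖ ^ 2) ^ 2) ∧
    (∀ R : ℝ, 1 ≤ R → ∀ c : T3 → ℝ, Measurable c → ∀ cB : ℝ, (∀ x, |c x| ≤ cB) →
      Integrable (fun p : T3 × V3 => Θ R p.2 * (c p.1 * Lκ p.1 p.2)) (volume.prod volume)) := by
  have hκ' : ∀ {X : Type} [TopologicalSpace X] {f : X → T3} {g : X → V3},
      Continuous f → Continuous g → Continuous fun x => κ (f x) (g x) := fun hf hg => hκ.comp (hf.prodMk hg)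
  have hpc : Continuous (Torus.proj : V3 → T3) := Torus.continuous_proj
  -- measurability, by `measurable_enskogL_of_continuous` with frozen profiles
  have hm : Measurable (fun p : T3 × V3 => Lκ p.1 p.2) := by
    have h := measurable_enskogL_of_continuous (Yf := fun _ _ => Y₀) (g := fun _ _ => ρ₀) (θf := fun _ _ => 1)
      (uf := fun _ _ => (0 : V3)) (φ := fun _ => κ) (xs := fun x _ => x)
      (ys := fun x ω => x + Torus.proj (ε • (ω : V3))) (lam := 1)
      continuous_const continuous_const continuous_const (fun _ _ => one_pos) continuous_const
      (hκ' continuous_snd.fst continuous_snd.snd) continuous_fst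
      (continuous_fst.add (hpc.comp ((continuous_subtype_val.comp continuous_snd).const_smul ε)))
      (fun _ x v => Lκ x v) (fun s x v => by
        rw [one_mul, hL]
        simp only [localMaxwellian_one_one_zero])
    exact h.comp ((measurable_const (a := (0 : ℝ))).prodMk measurable_id)
  -- the pointwise bound, by the gain/loss decomposition of `stub_kappaOperator`
  have hb : ∀ x v, |Lκ x v| ≤ 134 * π * (Y₀ * ρ₀) * C * (1 + ‖v‖ ^ 2) ^ 2 := by
    intro x v
    have hy : Continuous fun p : Metric.sphere (0 : V3) 1 × V3 => x + Torus.proj (ε • (p.1 : V3)) :=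
      continuous_const.add (hpc.comp ((continuous_subtype_val.comp continuous_fst).const_smul ε))
    have hg₂ : Continuous fun p : Metric.sphere (0 : V3) 1 × V3 => κ (x + Torus.proj (ε • (p.1 : V3))) p.2 :=
      hκ' hy continuous_snd
    obtain ⟨-, -, -, -, -, hid⟩ := stub_kappaOperator Y₀ ρ₀ C (κ x)
      (fun p => κ (x + Torus.proj (ε • (p.1 : V3))) p.2) (hκ' continuous_const continuous_id) hg₂
      (hκb x) (fun ω u => hκb _ u) v
    rw [hL x v, hid]
    have hsq : ∀ (p : Metric.sphere (0 : V3) 1 × V3) (y : T3),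
        |κ y (p.2 + ⟪v - p.2, (p.1 : V3)⟫_ℝ • (p.1 : V3))| ≤ C * (1 + ‖v‖ ^ 2) * (1 + ‖p.2‖ ^ 2) := by
      intro p y
      have h0 : 0 ≤ C * (‖v‖ ^ 2 * ‖p.2‖ ^ 2) := by positivity
      refine (hκb _ _).trans ?_
      nlinarith [(k2r_ref_ko_norm_sq_out_le v p.2 p.1).2]
    have hD : 0 ≤ C * (1 + ‖v‖ ^ 2) := by positivity
    obtain ⟨-, h1⟩ := k2r_ref_ok0_piece_le (g := fun p : Metric.sphere (0 : V3) 1 × V3 =>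
      κ x (p.2 + ⟪v - p.2, (p.1 : V3)⟫_ℝ • (p.1 : V3))) (hκ' continuous_const (by fun_prop)) hD v (fun p => hsq p x)
    obtain ⟨-, h2⟩ := k2r_ref_ok0_piece_le (g := fun p : Metric.sphere (0 : V3) 1 × V3 =>
      κ (x + Torus.proj (ε • (p.1 : V3))) (p.2 + ⟪v - p.2, (p.1 : V3)⟫_ℝ • (p.1 : V3)))
      (hκ' hy (by fun_prop)) hD v (fun p => hsq p _)
    obtain ⟨-, h4⟩ := k2r_ref_ok0_piece_le hg₂ hC v (fun p => hκb _ _)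
    have hcf := (stub_halfGaussian.2.2.2.2.2 v).2.1
    have hcf0 : 0 ≤ collisionFrequency v := le_trans (by positivity) (stub_halfGaussian.2.2.2.2.2 v).1
    have h3 : |collisionFrequency v * κ x v| ≤ π * (2 * (1 + ‖v‖ ^ 2)) * (C * (1 + ‖v‖ ^ 2)) := by
      rw [abs_mul, abs_of_nonneg hcf0]
      refine mul_le_mul (hcf.trans ?_) (hκb x v) (abs_nonneg _) (by positivity)
      refine mul_le_mul_of_nonneg_left ?_ Real.pi_pos.le
      calc Real.sqrt (‖v‖ ^ 2 + 3) ≤ Real.sqrt ((‖v‖ ^ 2 + 2) ^ 2) :=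
            Real.sqrt_le_sqrt (by nlinarith [sq_nonneg ‖v‖])
        _ = ‖v‖ ^ 2 + 2 := Real.sqrt_sq (by positivity)
        _ ≤ 2 * (1 + ‖v‖ ^ 2) := by nlinarith [sq_nonneg ‖v‖]
    have hA : 0 ≤ Y₀ * ρ₀ := mul_nonneg hY hρ
    have hlin : 4 * ‖v‖ + 9 ≤ 11 * (1 + ‖v‖ ^ 2) := by nlinarith [sq_nonneg (‖v‖ - 1), norm_nonneg v]
    rw [abs_mul, abs_of_nonneg hA]
    calc Y₀ * ρ₀ * |_| ≤ Y₀ * ρ₀ * (C * (1 + ‖v‖ ^ 2) * (4 * π * (4 * ‖v‖ + 9)) +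
          C * (1 + ‖v‖ ^ 2) * (4 * π * (4 * ‖v‖ + 9)) + π * (2 * (1 + ‖v‖ ^ 2)) * (C * (1 + ‖v‖ ^ 2)) +
          C * (4 * π * (4 * ‖v‖ + 9))) := by
          refine mul_le_mul_of_nonneg_left ?_ hA
          refine (abs_sub _ _).trans (add_le_add ((abs_sub _ _).trans (add_le_add ((abs_add_le _ _).trans
            (add_le_add h1 h2)) h3)) h4)
      _ ≤ 134 * π * (Y₀ * ρ₀) * C * (1 + ‖v‖ ^ 2) ^ 2 := by
          have h5 : C * (4 * π * (4 * ‖v‖ + 9)) ≤ C * (4 * π * (11 * (1 + ‖v‖ ^ 2))) * (1 + ‖v‖ ^ 2) := by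
            calc C * (4 * π * (4 * ‖v‖ + 9)) ≤ C * (4 * π * (11 * (1 + ‖v‖ ^ 2))) := by gcongr
              _ ≤ C * (4 * π * (11 * (1 + ‖v‖ ^ 2))) * (1 + ‖v‖ ^ 2) :=
                  le_mul_of_one_le_right (by positivity) (by nlinarith [sq_nonneg ‖v‖])
          have h6 : C * (1 + ‖v‖ ^ 2) * (4 * π * (4 * ‖v‖ + 9)) ≤ C * (1 + ‖v‖ ^ 2) * (4 * π * (11 * (1 + ‖v‖ ^ 2))) := by
            gcongr
          nlinarith [h5, h6, hA, Real.pi_pos, mul_nonneg hA (mul_nonneg hC Real.pi_pos.le)]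
  refine ⟨hm, hb, fun R hR c hc cB hcB => ?_⟩
  -- integrability on `𝕋³ × ℝ³`
  obtain ⟨hw01, hwc, -, hw4⟩ := k2r_ref_ok0_w_facts hΘ hR
  have hdom : Integrable (fun p : T3 × V3 => |cB| * (134 * π * (Y₀ * ρ₀) * C) * (Θ R p.2 * (1 + ‖p.2‖ ^ 2) ^ 4))
      ((volume : Measure T3).prod volume) := (hw4.const_mul _).comp_snd _
  refine hdom.mono' ?_ (Eventually.of_forall fun p => ?_)
  · exact ((hwc.measurable.comp measurable_snd).mul ((hc.comp measurable_fst).mul hm)).aestronglyMeasurable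
  · rw [Real.norm_eq_abs, abs_mul, abs_mul, abs_of_nonneg (hw01 p.2).1]
    have h14 : (1 + ‖p.2‖ ^ 2) ^ 2 ≤ (1 + ‖p.2‖ ^ 2) ^ 4 :=
      pow_le_pow_right₀ (by nlinarith [sq_nonneg ‖p.2‖]) (by norm_num)
    calc Θ R p.2 * (|c p.1| * |Lκ p.1 p.2|)
        ≤ Θ R p.2 * (|cB| * (134 * π * (Y₀ * ρ₀) * C * (1 + ‖p.2‖ ^ 2) ^ 4)) := by
          refine mul_le_mul_of_nonneg_left (mul_le_mul ((hcB p.1).trans (le_abs_self _))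
            ((hb p.1 p.2).trans ?_) (abs_nonneg _) (abs_nonneg _)) (hw01 p.2).1
          exact mul_le_mul_of_nonneg_left h14 (by positivity)
      _ = |cB| * (134 * π * (Y₀ * ρ₀) * C) * (Θ R p.2 * (1 + ‖p.2‖ ^ 2) ^ 4) := by ring

/-! ## The torus: the addition formula and the delocalised gain functional -/

omit hΘ hI in
/-- **Registered keyed sub-goal `stub_operatorKappaZero_prep2`** of stub `stub_operatorKappaZero` (line
`refutation` of crux K2R): the addition formula for the first coordinate character of `𝕋³` under the
delocalisation shift, `cos(2π(x − εω)₀) = cos(2πx₀) cos(2πε ω₀) + sin(2πx₀) sin(2πε ω₀)`. [folklore] -/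
theorem stub_operatorKappaZero_prep2 : ∀ (ε : ℝ) (x : UnitAddTorus (Fin 3)) (ω : EuclideanSpace ℝ (Fin 3)), Literature.Analysis.FunctionSpaces.Torus.cosCoord 0 (x - Literature.Analysis.FunctionSpaces.Torus.proj (ε • ω)) = Literature.Analysis.FunctionSpaces.Torus.cosCoord 0 x * Real.cos (2 * Real.pi * ε * ω 0) + Literature.Analysis.FunctionSpaces.Torus.sinCoord 0 x * Real.sin (2 * Real.pi * ε * ω 0) := by
  intro ε x ω
  obtain ⟨r, hr⟩ := Torus.exists_coe_eq (x 0)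
  have h1 : (x - Torus.proj (ε • ω)) 0 = ((r - ε * ω 0 : ℝ) : UnitAddCircle) := by
    rw [Pi.sub_apply, Torus.proj_smul_apply, ← hr, AddCircle.coe_sub]
  rw [Torus.cosCoord_of_eq h1, Torus.cosCoord_of_eq hr.symm, Torus.sinCoord_of_eq hr.symm,
    show 2 * π * (r - ε * ω 0) = 2 * π * r - 2 * π * ε * ω 0 by ring, Real.cos_sub]

/-- **The delocalised gain functional on the torus.** For a jointly continuous corrector `κ` with
`|κ(x, v)| ≤ C(1+|v|²)` and `Ψ(x, ω) = ∫ κ(x, U) I₀^R(U, ω) dU`: `Ψ` is bounded and jointly measurable,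
`x ↦ cos(2πx₀) ∫_{S²} Ψ(x + εω, ω) dσ` and `x ↦ ∫_{S²} [cos(2πx₀)cos(2πεω₀) + sin(2πx₀)sin(2πεω₀)] Ψ(x, ω) dσ`
are integrable on `𝕋³`, and their integrals agree (Fubini on `𝕋³ × S²`, translation invariance of the
Haar measure of `𝕋³`, and the addition formula). [folklore] -/
theorem k2r_ref_ok0_deloc_swap {R : ℝ} (hR : 1 ≤ R) {C : ℝ} {κ : T3 → V3 → ℝ} (hκ : Continuous (uncurry κ))
    (hκb : ∀ x v, |κ x v| ≤ C * (1 + ‖v‖ ^ 2)) (ε : ℝ) (Ψ : T3 → Metric.sphere (0 : V3) 1 → ℝ)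
    (hΨ : ∀ x ω, Ψ x ω = ∫ U : V3, κ x U * I R U ω) :
    Integrable (fun x : T3 => Torus.cosCoord 0 x *
      ∫ ω, Ψ (x + Torus.proj (ε • (ω : V3))) ω ∂(sphereMeasure : Measure (Metric.sphere (0 : V3) 1))) ∧
    Integrable (fun x : T3 => ∫ ω, (Torus.cosCoord 0 x * Real.cos (2 * π * ε * (ω : V3) 0) +
      Torus.sinCoord 0 x * Real.sin (2 * π * ε * (ω : V3) 0)) * Ψ x ω
        ∂(sphereMeasure : Measure (Metric.sphere (0 : V3) 1))) ∧
    ∫ x : T3, Torus.cosCoord 0 x *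
        ∫ ω, Ψ (x + Torus.proj (ε • (ω : V3))) ω ∂(sphereMeasure : Measure (Metric.sphere (0 : V3) 1)) =
      ∫ x : T3, ∫ ω, (Torus.cosCoord 0 x * Real.cos (2 * π * ε * (ω : V3) 0) +
        Torus.sinCoord 0 x * Real.sin (2 * π * ε * (ω : V3) 0)) * Ψ x ω
          ∂(sphereMeasure : Measure (Metric.sphere (0 : V3) 1)) := by
  haveI := isFiniteMeasure_sphereMeasure (E := V3)
  have hR0 : 0 < R := by linarith
  have hC : 0 ≤ C := by
    have h := hκb 0 0
    rw [norm_zero] at h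
    nlinarith [abs_nonneg (κ 0 0)]
  have hcos : Continuous (Torus.cosCoord (0 : Fin 3) : T3 → ℝ) := (Torus.isSmooth_cosCoord 0).continuous
  have hsin : Continuous (Torus.sinCoord (0 : Fin 3) : T3 → ℝ) := (Torus.isSmooth_sinCoord 0).continuous
  have hpc : Continuous (Torus.proj : V3 → T3) := Torus.continuous_proj
  -- joint measurability of `Ψ`
  have hIc := k2r_ref_ok0_continuous_I hI hR0
  have hG : Continuous fun q : (T3 × Metric.sphere (0 : V3) 1) × V3 => κ q.1.1 q.2 * I R q.2 q.1.2 :=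
    (hκ.comp (continuous_fst.fst.prodMk continuous_snd)).mul
      (hIc.comp (continuous_snd.prodMk (continuous_subtype_val.comp continuous_fst.snd)))
  have hΨm : StronglyMeasurable (fun q : T3 × Metric.sphere (0 : V3) 1 => Ψ q.1 q.2) := by
    rw [show (fun q : T3 × Metric.sphere (0 : V3) 1 => Ψ q.1 q.2) =
      fun q => ∫ U : V3, κ q.1 U * I R U q.2 from funext fun q => hΨ q.1 q.2]
    exact hG.stronglyMeasurable.integral_prod_right'
  -- the uniform bound
  set B : ℝ := (∫ w : V3, (1 + ‖w‖) ^ 3 * globalMaxwellian w) * ∫ v : V3, 4 * ((1 + ‖v‖ ^ 2) ^ 2 * Θ R v)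
  have hΨb : ∀ x ω, |Ψ x ω| ≤ C * B := by
    intro x ω
    obtain ⟨hQi, -, hQle⟩ := k2r_ref_ok0_Q_le hΘ hI hR ω
    have hI0 := k2r_ref_ok0_I_nonneg hΘ hI hR ω
    rw [hΨ, ← Real.norm_eq_abs]
    refine (norm_integral_le_of_norm_le (hQi.const_mul C) (Eventually.of_forall fun U => ?_)).trans ?_
    · rw [Real.norm_eq_abs, abs_mul, abs_of_nonneg (hI0 U)]
      calc |κ x U| * I R U ω ≤ C * (1 + ‖U‖ ^ 2) * I R U ω := mul_le_mul_of_nonneg_right (hκb x U) (hI0 U)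
        _ = C * ((1 + ‖U‖ ^ 2) * I R U ω) := by ring
    · rw [integral_const_mul]
      exact mul_le_mul_of_nonneg_left hQle hC
  -- the two integrands on `𝕋³ × S²`
  set f₁ : T3 → Metric.sphere (0 : V3) 1 → ℝ := fun x ω =>
    Torus.cosCoord 0 x * Ψ (x + Torus.proj (ε • (ω : V3))) ω with hf₁
  set f₂ : T3 → Metric.sphere (0 : V3) 1 → ℝ := fun x ω =>
    (Torus.cosCoord 0 x * Real.cos (2 * π * ε * (ω : V3) 0) +
      Torus.sinCoord 0 x * Real.sin (2 * π * ε * (ω : V3) 0)) * Ψ x ω with hf₂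
  have hsh : Measurable fun q : T3 × Metric.sphere (0 : V3) 1 => (q.1 + Torus.proj (ε • (q.2 : V3)), q.2) :=
    ((continuous_fst.add (hpc.comp ((continuous_subtype_val.comp continuous_snd).const_smul ε))).prodMk
      continuous_snd).measurable
  have hω0 : Continuous fun ω : Metric.sphere (0 : V3) 1 => (ω : V3) 0 :=
    (EuclideanSpace.proj (0 : Fin 3)).continuous.comp continuous_subtype_val
  have hf₁m : Measurable (uncurry f₁) :=
    (hcos.measurable.comp measurable_fst).mul (hΨm.measurable.comp hsh)
  have hf₂m : Measurable (uncurry f₂) := by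
    refine Measurable.mul (Continuous.measurable ?_) hΨm.measurable
    exact ((hcos.comp continuous_fst).mul ((Real.continuous_cos.comp ((hω0.comp continuous_snd).const_smul
      (2 * π * ε))))).add ((hsin.comp continuous_fst).mul (Real.continuous_sin.comp
        ((hω0.comp continuous_snd).const_smul (2 * π * ε))))
  have habs1 : ∀ x : T3, |Torus.cosCoord 0 x| ≤ 1 := fun x => Torus.abs_cosCoord_le 0 x
  have habs2 : ∀ (x : T3) (ω : Metric.sphere (0 : V3) 1), |Torus.cosCoord 0 x * Real.cos (2 * π * ε * (ω : V3) 0) +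
      Torus.sinCoord 0 x * Real.sin (2 * π * ε * (ω : V3) 0)| ≤ 2 := fun x ω => by
    obtain ⟨r, hr⟩ := Torus.exists_coe_eq (x 0)
    rw [Torus.cosCoord_of_eq hr.symm, Torus.sinCoord_of_eq hr.symm]
    refine (abs_add_le _ _).trans ?_
    rw [abs_mul, abs_mul]
    nlinarith [Real.abs_cos_le_one (2 * π * r), Real.abs_sin_le_one (2 * π * r),
      Real.abs_cos_le_one (2 * π * ε * (ω : V3) 0), Real.abs_sin_le_one (2 * π * ε * (ω : V3) 0),
      abs_nonneg (Real.cos (2 * π * r)), abs_nonneg (Real.sin (2 * π * r))]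
  have hf₁i : Integrable (uncurry f₁) ((volume : Measure T3).prod sphereMeasure) := by
    refine (integrable_const (C * B)).mono' hf₁m.aestronglyMeasurable (Eventually.of_forall fun q => ?_)
    rw [uncurry_def, hf₁, Real.norm_eq_abs, abs_mul]
    exact (mul_le_mul (habs1 q.1) (hΨb _ _) (abs_nonneg _) zero_le_one).trans_eq (one_mul _)
  have hf₂i : Integrable (uncurry f₂) ((volume : Measure T3).prod sphereMeasure) := by
    refine (integrable_const (2 * (C * B))).mono' hf₂m.aestronglyMeasurable (Eventually.of_forall fun q => ?_)
    rw [uncurry_def, hf₂, Real.norm_eq_abs, abs_mul]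
    exact mul_le_mul (habs2 q.1 q.2) (hΨb _ _) (abs_nonneg _) zero_le_two
  have hpull : ∀ x : T3, ∫ ω, f₁ x ω ∂sphereMeasure =
      Torus.cosCoord 0 x * ∫ ω, Ψ (x + Torus.proj (ε • (ω : V3))) ω ∂sphereMeasure := fun x => by
    rw [hf₁, ← integral_const_mul]
  refine ⟨hf₁i.integral_prod_left.congr (Eventually.of_forall hpull), hf₂i.integral_prod_left, ?_⟩
  -- translation invariance on `𝕋³` and the addition formula, between two Fubini exchanges
  have htr : ∀ ω : Metric.sphere (0 : V3) 1, ∫ x : T3, f₁ x ω = ∫ x : T3, f₂ x ω := by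
    intro ω
    have h := integral_add_right_eq_self (μ := (volume : Measure T3))
      (fun x => Torus.cosCoord 0 (x - Torus.proj (ε • (ω : V3))) * Ψ x ω) (Torus.proj (ε • (ω : V3)))
    simp only [add_sub_cancel_right] at h
    rw [hf₁, hf₂]
    dsimp only
    rw [h]
    exact integral_congr_ae (Eventually.of_forall fun x => by beta_reduce; rw [stub_operatorKappaZero_prep2])
  calc ∫ x : T3, Torus.cosCoord 0 x * ∫ ω, Ψ (x + Torus.proj (ε • (ω : V3))) ω ∂sphereMeasure
      = ∫ x : T3, ∫ ω, f₁ x ω ∂sphereMeasure := integral_congr_ae (Eventually.of_forall fun x => (hpull x).symm)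
    _ = ∫ ω, (∫ x : T3, f₁ x ω) ∂sphereMeasure := integral_integral_swap hf₁i
    _ = ∫ ω, (∫ x : T3, f₂ x ω) ∂sphereMeasure := integral_congr_ae (Eventually.of_forall htr)
    _ = ∫ x : T3, ∫ ω, f₂ x ω ∂sphereMeasure := (integral_integral_swap hf₂i).symm

end Summit.AtomisticToContinuum.HydrodynamicLimit.Theorems.EnskogAdjointDuality
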